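import Summits.QuantumFields.BalabanUV.T4Continuum.Support.NE9CurChartGaugeOrbit
import Literature.MathematicalPhysics.QuantumFieldTheory.Balaban1983to89.B9Thm311SmallPlaquettes

/-!
# NE9CurChartSmallPlaquettes — THE SPECIES FACE (Ψ1)–(Ψ3) OF `cur U` ON ONE BALL AT EVERY UNIT-BOUNDED UNITARY BACKGROUND `U` OF A FIXED LATTICE
# WHOSE PLAQUETTE VARIABLES AND CLOSED COORDINATE LINES ARE CLOSE TO `1` — the instancer's datum for Bałaban's `U_k` in print's GAUGE-INVARIANT form
# ([Balaban1987RG1] (1.11)–(1.12) ∕ [Balaban1985BackgroundPropagators] (3.35) on the one-cube torus), the small gauge CONSTRUCTED (this lineage's torus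
# axial gauge `B7Eq44TorusAxialGauge`), NOT given: this lineage's (G8) v1.1 `Support/NE9CurChartGaugeOrbit.cur_chart_exists_of_gaugeOrbit_small_bonds_unitary`
# AT `U` ITSELF via `U = V^{g′}`, `V := U^g` small-bond; cell `pub-balaban`, T4-DAG §2 node U3 ∕ §6 NE9, route R2′; Summits-side NEW leaf under this
# seat's INTERFACE REQUEST NE9 (ruling e34b3e0c (0) — requested: `NE9CurChartSmallPlaquettes.cur_chart_exists_of_small_plaquettes_unitary`), nothing
# printed asserted

HONEST FRAMING (T4-DAG PAGE 1).  Rung (B)+1 of the FINITE-VOLUME T⁴ programme — NOT infinite volume, NOT a mass gap, NOT the Clay problem.  NE9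
(`T4OutputRate.NE9` ∧ `FadingMemory`) is a cell NEW ESTIMATE, NOT PRINTED in [I] = [Balaban1987RG1] (CMP **109**), [II] = [Balaban1988RG2Cluster]
(CMP **116**), and NOT PROVED here («NE9 ⇐ the named binders»; spine PROVED 0∕9).  HONEST DEPENDENCY (cell line, verbatim): continuum YM on T⁴ ⇐
BetaPertH ∧ nine spine estimates (0/9 proved); BetaPertH ⇐ (D1) ∧ (D4) ∧ CAP+tail; G-an2-4 gates asym, D1 and NE2/3/4.  The `cur U` OBJECT is ONE
item of the MODEL O-NE9-1 (species (a) data); the END's `act` ∕ `ker` halves and NEEDS-COORDINATOR #5 are untouched.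

THE PRINT (loci only).  [Balaban1987RG1] p. 262 (1.11)–(1.12): *«|∂U − 1| < α₀ξ² on X, (1.11) for each cube □ ⊂ X of a size O(1)LM there exists a
G-valued gauge transformation u defined on □ and such, that U^u = exp iξA, |A|, |∇^ξA| < O(1)LMBα₀ on □, (1.12)»*; [Balaban1985BackgroundPropagators]
p. 396 (3.35), (3.34) *«Δ_a(U^u) = R(u)Δ_a(U)R(u⁻¹), G(U^u) = R(u)G(U)R(u⁻¹)»*; [Balaban1985Averaging] p. 24 (the axial gauge, (45)).  The OWNER's (A′)
`NE9CurChartUniformBall.cur_chart_exists_of_small_bonds_unitary` displays the background through {`U(b) ∈ U1`, unitary, `‖U(b) − 1‖ ≤ ε`} IN THE GIVEN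
GAUGE («the instancer's datum for Bałaban's U_k in a small gauge»); here the datum is the gauge-invariant pair (plaquette deviation `δ`, closed-line
deviation `θ`) and a radius `ε ≥ d(N−1)²δ + θ` — on a TORUS the closed lines cannot be dropped (`B7Eq45TorusGaugeOrbit.not_small_bond_orbit_slice`).

WHAT THIS FILE PROVES (ONE theorem; 0 def, 0 sorry, axioms standard).  **`cur_chart_exists_of_small_plaquettes_unitary`**: (G8) v1.1's `∃ ε₃ ≤ ε_reg(d, L)
∀ C₄ a₃ ∃ ε₄ εC Rb R′` (THE SAME numbers) such that for EVERY background `U` of the fixed lattice `T_{L·m}` with `U(b) ∈ U1`, `U(b)* = U(b)⁻¹`, ALL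
plaquette variables `≤ δ`, ALL closed coordinate lines `≤ θ` (`L·m_i ≤ N`), a radius `ε` with `d(N−1)²δ + θ ≤ ε ≤ ε₃`, `ε ≤ ε_reg(d, L)`, and every
(L3)-slot `Wq` (`QuadAnalytic Wq C₄ a₃`, analytic on `‖Y‖ < a₃`) AT `∇_U`: `hpos′(U)` HOLDS and (Ψ1)–(Ψ3) hold for the chart of `cur U` on
`ball 0 Rb → ball 0 R′` — AT `U` IN ITS GIVEN GAUGE, E162's structural slots of `U` PRODUCED (`alpha_le_64`, `perCfg_mem_U1`,
`B9Thm311SmallPlaquettes.hreg_of_small_plaquettes`, `alphaL_le_half`).  MECHANISM: `B7Eq45TorusGaugeOrbit.exists_small_bond_gauge_unitary` writes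
`U = V^{g′}`; `obtain ⟨V, g′, …, rfl⟩`; (G8) v1.1 at `(V, g′)` IS the goal, the structural proof slots agreeing by proof irrelevance.
DISGUISE TEST: composition of landed theorems; no inequality of the series proved; per-LATTICE numbers — NOT print's uniformity in the lattice, NOT
print's per-cube O(1)LM, NOT p. 416's per-cube locality reduction; not NE9.
References (TYPES ∕ loci only): [Balaban1985Variational] (45)–(47) p. 285, Prop. 6 (117)–(121) p. 295, (172)–(175) p. 305;
[Balaban1985BackgroundPropagators] (3.28)–(3.35) pp. 395–396, Thm 3.11 p. 416; [Balaban1985Averaging] (44)–(45) p. 24; [Balaban1987RG1] (1.10)–(1.12) p. 262.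
Imports `Support/NE9CurChartGaugeOrbit` (this lineage, (G8)) and `B9Thm311SmallPlaquettes` (this lineage, (A2b)) ONLY; modifies nothing; no END
re-wired.  Value = route R2′ bookkeeping at rung (B)+1 (the species' face on print's gauge-invariant regularity class of the one-cube torus), NOT summit
progress.
-/

noncomputable section

open Metric Set
open scoped InnerProductSpace

namespace Summit.QuantumFields.BalabanUV.T4Continuum.NE9CurChartSmallPlaquettes

open Literature.MathematicalPhysics.QuantumFieldTheory.Balaban1983to89
open B11Eq103H1Complex B11Eq115Space B11Eq174Chart
open B11Eq111FrakG (nabla115)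
open B13Contraction113 (QuadAnalytic)
open B9Eq319QprimeTorus (fineP)
open B9SectCLatticeCarrier (Bond)
open B4Sect5Torus (TSite)
open B7Prop1Explicit (U1)
open B9Eq315QTorus (laplaceAofBackground)
open B9Eq315QTorusOnto (QtorusW_surjective)
open B9Eq310DeltaPrime (plaqHolU)
open B9Eq335SmallBondsData (perCfg_mem_U1 alpha_le_64 alphaL_le_half)
open B11Eq44COperatorTorus (Cc)
open B7Eq44TorusAxialGauge (lineHolT)
open B7Eq45TorusGaugeOrbit (exists_small_bond_gauge_unitary)
open B9Thm311SmallPlaquettes (hreg_of_small_plaquettes)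
open Summit.QuantumFields.BalabanUV.T4Continuum.NE9CurChartGaugeOrbit (cur_chart_exists_of_gaugeOrbit_small_bonds_unitary)

set_option maxRecDepth 8192 in
/-- **THE SPECIES FACE OF `cur U` ON ONE BALL AT EVERY UNIT-BOUNDED UNITARY BACKGROUND WITH SMALL PLAQUETTE VARIABLES AND SMALL CLOSED COORDINATE
LINES** — (G8) v1.1 `cur_chart_exists_of_gaugeOrbit_small_bonds_unitary` AT `U` ITSELF: background binders {`U(b) ∈ U1`, `U(b)* = U(b)⁻¹`, `‖U(∂p) − 1‖ ≤ δ`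
(all plaquettes), `‖U(C_{x,μ}) − 1‖ ≤ θ` (all closed lines), `L·m_i ≤ N`, `d(N−1)²δ + θ ≤ ε ≤ ε₃`, `ε ≤ ε_reg(d, L)`} — GAUGE-INVARIANT data and a
radius, NO gauge given; E162's structural slots of `U` PRODUCED (`perCfg_mem_U1`, `hreg_of_small_plaquettes`); the same `∃`-numbers as (G8) v1.1;
conclusion = `∃ hpos′ ∧ (Ψ1)–(Ψ3)` at `∇_U` for every admissible (L3)-slot `Wq`.  `U = V^{g′}` by `B7Eq45TorusGaugeOrbit.exists_small_bond_gauge_unitary`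
(the torus axial gauge), then (G8) v1.1 at `(V, g′)` verbatim.  Print's (1.12) ∕ (3.35) shape on the one-cube torus; the closed-line binder is the
torus's price (no-go `B7Eq45TorusGaugeOrbit.not_small_bond_orbit_slice`). [folklore] -/
theorem cur_chart_exists_of_small_plaquettes_unitary {d : ℕ} (L : ℕ) [NeZero L] (m : Fin d → ℕ) [∀ i, NeZero (fineP L m i)] (hL : 1 ≤ L)
    {𝔸 : Type*} [NormedRing 𝔸] [NormedAlgebra ℂ 𝔸] [CompleteSpace 𝔸] [NormOneClass 𝔸] [StarRing 𝔸] [NormedStarGroup 𝔸] [StarModule ℂ 𝔸]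
    [FiniteDimensional ℂ 𝔸]
    {W : Type*} [NormedAddCommGroup W] [InnerProductSpace ℂ W] [FiniteDimensional ℂ W] (φ : W ≃ₗ[ℂ] 𝔸) {Mφ Mφ' : ℝ} (hMφ : 0 ≤ Mφ)
    (hMφ' : 0 ≤ Mφ') (hφ : ∀ w, ‖φ w‖ ≤ Mφ * ‖w‖) (hφ' : ∀ X, ‖φ.symm X‖ ≤ Mφ' * ‖X‖)
    (τ : 𝔸 →ₗ[ℂ] ℂ) {Cτ : ℝ} (hτ : ∀ X, ‖τ X‖ ≤ Cτ * ‖X‖) (hCτ : 0 ≤ Cτ)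
    (hτφ : ∀ X Y : 𝔸, inner ℂ (φ.symm X) (φ.symm Y) = τ (star X * Y)) (htr : ∀ X Y : 𝔸, τ (X * Y) = τ (Y * X))
    {η : ℝ} [Fact (0 < (L : ℝ))] [Fact (0 < η)] {lev₀ : Bond d (fineP L m) → ℕ} {levB : Bond d m → ℕ} (lev₁ : Bond d (fineP L m) × Fin d → ℕ)
    (hlev : ∀ b, 1 ≤ lev₀ b) {c₀ c₁ : ℝ} [Fact (0 < c₀)] [Fact (0 < c₁)] {a : ℝ} (ha : 0 < a) :
    ∃ ε₃ : ℝ, 0 < ε₃ ∧ ε₃ ≤ 1 / (256 * ((d : ℝ) + 1) ^ 2 * (L : ℝ) ^ (d + 1)) ∧ ∀ {C₄ a₃ : ℝ}, 0 ≤ C₄ → 0 < a₃ →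
      ∃ ε₄ εC Rb R' : ℝ, 0 < Rb ∧ 0 < R' ∧
      ∀ (U : Bond d (fineP L m) → 𝔸ˣ) (hU : ∀ b, U b ∈ U1 𝔸), (∀ b, star (U b : 𝔸) = (((U b)⁻¹ : 𝔸ˣ) : 𝔸)) →
      ∀ {N : ℕ} (hN : ∀ i, fineP L m i ≤ N) {δ : ℝ} (hδ0 : 0 ≤ δ) (hδ : ∀ p : B9SectCLatticeCarrier.Plaq d (fineP L m), ‖(plaqHolU U p : 𝔸) - 1‖ ≤ δ)
        {θ : ℝ} (hθ0 : 0 ≤ θ) (hθ : ∀ (x : TSite d (fineP L m)) (μ : Fin d), ‖((lineHolT (fineP L m) U x μ : 𝔸ˣ) : 𝔸) - 1‖ ≤ θ)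
        {ε : ℝ} (hε : 0 ≤ ε) (hεb : (d : ℝ) * ((N : ℝ) - 1) ^ 2 * δ + θ ≤ ε)
        (hεr : ε ≤ 1 / (256 * ((d : ℝ) + 1) ^ 2 * (L : ℝ) ^ (d + 1))), ε ≤ ε₃ →
      ∀ {Wq : Space115 (L : ℝ) η lev₀ lev₁ (nabla115 η U) → NegSize (L : ℝ) η lev₀ 3 𝔸}, QuadAnalytic Wq C₄ a₃ →
        AnalyticOnNhd ℂ Wq {Y | ‖Y‖ < a₃} →
      ∃ hpos : ∀ x : BondL2K ℂ d (fineP L m) c₀ W, x ≠ 0 →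
          0 < RCLike.re (inner ℂ x (laplaceAofBackground L m hL φ U (alpha_le_64 hL hε hεr) (perCfg_mem_U1 L m hU)
            (hreg_of_small_plaquettes L m hU hN hδ0 hδ hθ0 hθ hε hεb) τ η (c₀ := c₀) (c₁ := c₁) a x)),
      let Hc := H1LatticeCLM (lev₀ := lev₀) (levB := levB) φ hpos (QtorusW_surjective L m hL U (alpha_le_64 hL hε hεr)
        (perCfg_mem_U1 L m hU) (hreg_of_small_plaquettes L m hU hN hδ0 hδ hθ0 hθ hε hεb) (alphaL_le_half hL hεr) φ) lev₁ (nabla115 η U)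
      let Gc := frakGLatticeCLM (lev₀ := lev₀) φ hpos (QtorusW_surjective L m hL U (alpha_le_64 hL hε hεr)
        (perCfg_mem_U1 L m hU) (hreg_of_small_plaquettes L m hU hN hδ0 hδ hθ0 hθ hε hεb) (alphaL_le_half hL hεr) φ) lev₁ (nabla115 η U)
      let Cx := Cc L m η U lev₀ lev₁ (nabla115 η U) levB
      DifferentiableOn ℂ (chartHB Gc 0 Wq 0 (fun A' => A' + solA Hc 0 Cx 0 εC A') ε₄ Hc) (ball (0 : NegSize (L : ℝ) η levB 0 𝔸) Rb) ∧
      MapsTo (chartHB Gc 0 Wq 0 (fun A' => A' + solA Hc 0 Cx 0 εC A') ε₄ Hc) (ball (0 : NegSize (L : ℝ) η levB 0 𝔸) Rb)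
          (ball (0 : Space115 (L : ℝ) η lev₀ lev₁ (nabla115 η U)) R') ∧
      chartHB Gc 0 Wq 0 (fun A' => A' + solA Hc 0 Cx 0 εC A') ε₄ Hc 0 = 0 := by
  obtain ⟨ε₃, hε₃, hle, H⟩ := cur_chart_exists_of_gaugeOrbit_small_bonds_unitary L m hL φ hMφ hMφ' hφ hφ' τ hτ hCτ hτφ htr (η := η) (levB := levB)
    lev₁ hlev (c₀ := c₀) (c₁ := c₁) ha
  refine ⟨ε₃, hε₃, hle, fun {C₄ a₃} hC₄ ha₃ => ?_⟩
  obtain ⟨ε₄, εC, Rb, R', hRb0, hR'0, H'⟩ := H hC₄ ha₃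
  refine ⟨ε₄, εC, Rb, R', hRb0, hR'0, ?_⟩
  intro U hU hUstar N hN δ hδ0 hδ θ hθ0 hθ ε hε hεb hεr hεm Wq hW hWa
  obtain ⟨V, g', hV, hVstar, hVε, hg', hg'star, rfl⟩ := exists_small_bond_gauge_unitary (fineP L m) hU hN hδ0 hδ hθ0 hθ hUstar
  exact H' V hV hε hεr hεm (fun b => (hVε b).trans hεb) hVstar hg' hg'star hW hWa

end Summit.QuantumFields.BalabanUV.T4Continuum.NE9CurChartSmallPlaquettes

end
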